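import Summits.Ventures.PercRepro.Night2LocalD2FarPre

/-!
# PercRepro — the coloop cell when the coloop is avoided by every member (night-2, gen 15)

First piece of the `kColoops = 1` cell of the (6,4) row (`|E ∖ G| = 2`): let `y ∈ G` be a coloop of `M|G`
(`ρ(G ∖ y) ≤ q`).  If `E ∖ y` has rank `≤ q + 1` — the two points of `E ∖ G` span, with `G ∖ y`, a hyperplane of
`M` («the `D`-line meets `G` inside `G ∖ y`») — then no member contains `y` (`ρ(E ∖ B) = q + 2` forces
`E ∖ B ⊄ E ∖ y`), every shadow set `S ∋ y` has at most ONE covering preimage (`S ∖ y`), and the covering certificate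
`localShadowHall_of_cover_sum` closes (LI_G) with room (`1/|E ∖ cl B| ≤ 1/2 ≤ (q+1)/(q+2)`).

* `notMem_of_rkN_erase_le` — `ρ(E ∖ y) ≤ q + 1` ⟹ `y ∉ B` for every bottom set `B ∈ Uq M (q+2) q`.
* `card_coverPreimages_le_one_of_coloop_avoided` — `y` a coloop of `M|G` avoided by every member ⟹ `≤ 1` covering
  preimage at every shadow set.
* **`localShadowHall_of_coloop_avoided`**, **`localShadowHall_of_rkN_erase_le`** — (LI_G) at such a flat.

What remains of the `kColoops = 1` cell is `ρ(E ∖ y) = 6` (the members `K ∪ {y}` exist): NIGHT-2-k1.md.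
-/

namespace PercRepro.Shadow

open Finset PerFlat ThmH

variable {α : Type*} [DecidableEq α] {M : Matroid α} [M.Finite]

/-- If `E ∖ y` has rank `≤ q + 1`, no bottom set of `Uq M (q+2) q` contains `y`. -/
theorem notMem_of_rkN_erase_le {q : ℕ} {y : α} (hr : rkN M ((gr M).erase y) ≤ q + 1) {B : Finset α}
    (hB : B ∈ Uq M (q + 2) q) : y ∉ B := by
  intro hyB
  have h6 := rkN_sdiff_eq_of_mem_Uq hB
  have hsub : gr M \ B ⊆ (gr M).erase y := by
    intro e he
    rw [Finset.mem_sdiff] at he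
    rw [Finset.mem_erase]
    exact ⟨fun h => he.2 (h ▸ hyB), he.1⟩
  have := rkN_mono (M := M) hsub
  omega

/-- A shadow set at `G` contains every coloop `y` of `M|G` (`ρ(G ∖ y) ≤ q < q + 1 = ρ(S)`). -/
theorem mem_of_mem_shadowAt_of_coloop {q : ℕ} {G : Finset α} {y : α}
    (hy : rkN M (G.erase y) ≤ q) {S : Finset α} (hS : S ∈ shadowAt M (q + 2) q (Uq M (q + 2) q) G) : y ∈ S := by
  by_contra hyS
  have hSG : S ⊆ G := subset_of_mem_shadowAt hS
  have hSY : S ∈ Yq M (q + 2) q := shadow_subset_Yq _ (mem_shadowAt.1 hS).1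
  have hSr : rkN M S = q + 1 := by
    unfold rkN; rw [eRk_eq_of_mem_Yq_diag hSY]; rfl
  have hsub : S ⊆ G.erase y := by
    intro e he
    rw [Finset.mem_erase]
    exact ⟨fun h => hyS (h ▸ he), hSG he⟩
  have := rkN_mono (M := M) hsub
  omega

open scoped Classical in
/-- If the coloop `y` of `M|G` lies in no member, every shadow set has at most one covering preimage (`S ∖ y`). -/
theorem card_coverPreimages_le_one_of_coloop_avoided {q : ℕ} {G : Finset α} {y : α}
    (hy : rkN M (G.erase y) ≤ q) (hmem : ∀ B ∈ membersIn M (Uq M (q + 2) q) G, y ∉ B)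
    {S : Finset α} (hS : S ∈ shadowAt M (q + 2) q (Uq M (q + 2) q) G) :
    (coverPreimages M (Uq M (q + 2) q) G S).card ≤ 1 := by
  have hyS := mem_of_mem_shadowAt_of_coloop hy hS
  have key : ∀ B ∈ coverPreimages M (Uq M (q + 2) q) G S, B = S.erase y := by
    intro B hB
    obtain ⟨hBm, hcov⟩ := mem_coverPreimages.1 hB
    obtain ⟨x, -, rfl⟩ := mem_coverSets.1 hcov
    have hyB : y ∉ B := hmem B hBm
    have hxy : y = x := by
      rw [Finset.mem_insert] at hyS
      rcases hyS with h | h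
      · exact h
      · exact absurd h hyB
    subst hxy
    rw [Finset.erase_insert hyB]
  rw [Finset.card_le_one]
  intro B hB B' hB'
  rw [key B hB, key B' hB']

open scoped Classical in
/-- **(LI_G) when the coloop `y` of `M|G` lies in no member** (the covering certificate with one preimage). -/
theorem localShadowHall_of_coloop_avoided {q : ℕ} {G : Finset α} (hG : G ∈ flatsQ M (q + 1)) {y : α}
    (hy : rkN M (G.erase y) ≤ q) (hmem : ∀ B ∈ membersIn M (Uq M (q + 2) q) G, y ∉ B) :
    LocalShadowHall M q G := by
  apply localShadowHall_of_cover_sum hG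
  intro S hS
  have hterm : ∀ B ∈ coverPreimages M (Uq M (q + 2) q) G S,
      (1 : ℚ) / ((gr M \ clF M B).card : ℚ) ≤ 1 / 2 := by
    intro B hB
    have hBU : B ∈ Uq M (q + 2) q := (mem_membersIn.1 (mem_coverPreimages.1 hB).1).1
    have h2 := two_le_card_compl_clF hBU
    have h2' : (2 : ℚ) ≤ ((gr M \ clF M B).card : ℚ) := by exact_mod_cast h2
    exact one_div_le_one_div_of_le (by norm_num) h2'
  have hcard := card_coverPreimages_le_one_of_coloop_avoided hy hmem hS
  have hq : (0 : ℚ) ≤ q := by positivity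
  calc ∑ B ∈ coverPreimages M (Uq M (q + 2) q) G S, (1 : ℚ) / ((gr M \ clF M B).card : ℚ)
      ≤ ∑ B ∈ coverPreimages M (Uq M (q + 2) q) G S, (1 / 2 : ℚ) := Finset.sum_le_sum hterm
    _ = ((coverPreimages M (Uq M (q + 2) q) G S).card : ℚ) * (1 / 2) := by
        rw [Finset.sum_const, nsmul_eq_mul]
    _ ≤ 1 * (1 / 2) := by
        apply mul_le_mul_of_nonneg_right _ (by norm_num)
        exact_mod_cast hcard
    _ ≤ ((q : ℚ) + 1) / ((q : ℚ) + 2) := by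
        rw [one_mul, div_le_div_iff₀ (by norm_num) (by positivity)]
        linarith

open scoped Classical in
/-- **(LI_G) at a flat with a coloop `y` of `M|G` when `ρ(E ∖ y) ≤ q + 1`** — in the (6,4) row (`q = 4`,
`|E ∖ G| = 2`): the cell `kColoops = 1` when the two outside points together with `G ∖ y` span only a hyperplane. -/
theorem localShadowHall_of_rkN_erase_le {q : ℕ} {G : Finset α} (hG : G ∈ flatsQ M (q + 1)) {y : α}
    (hy : rkN M (G.erase y) ≤ q) (hr : rkN M ((gr M).erase y) ≤ q + 1) : LocalShadowHall M q G :=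
  localShadowHall_of_coloop_avoided hG hy
    (fun _ hB => notMem_of_rkN_erase_le hr (mem_membersIn.1 hB).1)

end PercRepro.Shadow
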